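import Summits.RiemannHypothesis.RiemannHypothesis.Theorems.HandoffLatticeUncertainty
import Literature.NumberTheory.LFunctions.NymanBeurling
import HarnessLib

/-!
# THEOREM N(b), part 1/2 — the fibre test functions, their Beurling form, and Nyman's integrals on `(0, 1/2]`

Handoff track (ROUTE 1′), prove-1 gen14, ATTEMPT-21 §8. Companion of `HandoffLatticeUncertainty*`
(THEOREM U0). There the FREE ratio `latticeTail/leakage` of idea-1's (U-LATTICE) was shown to be
degenerate. Here the normalisation is dropped and ONE fibre is fixed: the window datum `1_{(1/2,1]}`
over the window `[1/2, 2]` (`λ = 2`), completed below `1/2` by an arbitrary finite step function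
`Σ_j c_j 1_{(0,b_j]}` (`0 < b_j ≤ 1/2`) of the right mass (`Σ c_j b_j = -1/2`, i.e. `∫ f = 0`, CC's 𝒮₀
condition). THEOREM (`riemannHypothesis_of_latticeTail_fibre`, in part 2/2 `HandoffLatticeNymanRH`): if such
completions of arbitrarily small lattice tail `∫_0^{1/2} |Σ_n f(nu)|² du` exist, then `RiemannHypothesis`.
THIS FILE: `piece`, `fibreFn`, `dilationSum_fibreFn(_eq)` (the Beurling form), the bound
`norm_dilationSum_fibreFn_le`, Nyman's integrals `nymanInt_small` / `nymanInt_one`, `half_cpow`.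

Mechanism (Nyman 1950 / Beurling 1955 transported by one identity): `Σ_{n≥1} 1_{(0,b]}(nu) = ⌊b/u⌋
= b/u - {b/u}`, so for a mass-zero step `f` the dilation sum is the Beurling function
`θ_f(u) = -Σ_j c_j {b_j/u}` (`dilationSum_fibreFn_eq`); if `ζ(s) = 0` with `1/2 < Re s < 1`, Nyman's
formula `∫_0^1 {1/(kt)} t^{s-1} dt = 1/(k(s-1)) - k^{-s}ζ(s)/s` (TREE:
`Literature.NumberTheory.LFunctions.mellin_beurlingRhoTrunc_eq`) makes the pairing
`∫_0^{1/2} θ_f(u) u^{s-1} du` equal to `(2^{-s} - 1)/s ≠ 0` for EVERY admissible completion (the mass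
condition cancels the inner pieces), and Cauchy–Schwarz in `L²(0, 1/2)` (`u^{s-1} ∈ L²` iff
`Re s > 1/2`) bounds the lattice tail below; zeros with `Re s < 1/2` are excluded by the functional
equation (TREE: `quasiRiemannHypothesis_one_half_iff_holds`). The converse (RH ⟹ such completions
exist, for every datum) is Báez-Duarte's theorem (TREE: `baezDuarte_iff_holds`) plus Beurling's
dilation step — ATTEMPT-21 §8.2, not formalised here. This is the EASY half of Nyman–Beurling in
idea-1's coordinates: an implication to RH from an open density statement, no evidence for RH.
-/

set_option linter.dupNamespace false

noncomputable section

open Complex MeasureTheory Set Filter Finset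
open scoped Real FourierTransform

namespace Summit.RiemannHypothesis.RiemannHypothesis.Theorems

namespace LatticeUncertainty

open Literature.NumberTheory.LFunctions

/-! ## The fibre test functions and their dilation sums -/

/-- The one-sided step piece `1_{(0,b]}`. -/
def piece (b x : ℝ) : ℂ := if 0 < x ∧ x ≤ b then 1 else 0

/-- The fibre test function: the window datum `1_{(1/2,1]} = 1_{(0,1]} - 1_{(0,1/2]}` plus an inner
step completion `Σ_j c_j 1_{(0,b_j]}`. -/
def fibreFn {n : ℕ} (c : Fin n → ℂ) (b : Fin n → ℝ) (x : ℝ) : ℂ :=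
  piece 1 x - piece (1 / 2) x + ∑ j, c j * piece (b j) x

/-- `Σ_{1 ≤ m ≤ ⌊2/u⌋} 1_{(0,b]}(mu) = ⌊b/u⌋` for `0 ≤ b ≤ 2`, `u > 0`. -/
theorem sum_piece_eq_floor {b u : ℝ} (hu : 0 < u) (hb0 : 0 ≤ b) (hb : b ≤ 2) :
    ∑ m ∈ Finset.Icc 1 ⌊2 / u⌋₊, piece b (m * u) = (⌊b / u⌋₊ : ℂ) := by
  have hN : ⌊b / u⌋₊ ≤ ⌊2 / u⌋₊ := Nat.floor_le_floor (div_le_div_of_nonneg_right hb hu.le)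
  have hterm : ∀ m ∈ Finset.Icc 1 ⌊2 / u⌋₊,
      piece b (m * u) = if m ∈ Finset.Icc 1 ⌊b / u⌋₊ then (1 : ℂ) else 0 := by
    intro m hm
    have hm1 : 1 ≤ m := (Finset.mem_Icc.1 hm).1
    have hmpos : (0 : ℝ) < m * u := by
      have : (1 : ℝ) ≤ m := by exact_mod_cast hm1
      positivity
    unfold piece
    have hiff : (0 < (m : ℝ) * u ∧ (m : ℝ) * u ≤ b) ↔ m ∈ Finset.Icc 1 ⌊b / u⌋₊ := by
      rw [Finset.mem_Icc, Nat.le_floor_iff (div_nonneg hb0 hu.le), le_div_iff₀ hu]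
      exact ⟨fun h ↦ ⟨hm1, h.2⟩, fun h ↦ ⟨hmpos, h.2⟩⟩
    by_cases h : 0 < (m : ℝ) * u ∧ (m : ℝ) * u ≤ b
    · rw [if_pos h, if_pos (hiff.1 h)]
    · rw [if_neg h, if_neg (fun h' ↦ h (hiff.2 h'))]
  rw [Finset.sum_congr rfl hterm, ← Finset.sum_filter]
  have hset : (Finset.Icc 1 ⌊2 / u⌋₊).filter (fun m ↦ m ∈ Finset.Icc 1 ⌊b / u⌋₊)
      = Finset.Icc 1 ⌊b / u⌋₊ := by
    ext m; simp only [Finset.mem_filter, Finset.mem_Icc]; omega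
  rw [hset]
  simp

/-- The dilation sum of the fibre test function over the window `[1/2, 2]`, in floors. -/
theorem dilationSum_fibreFn {n : ℕ} (c : Fin n → ℂ) (b : Fin n → ℝ)
    (hb : ∀ j, 0 < b j ∧ b j ≤ 1 / 2) {u : ℝ} (hu : 0 < u) :
    dilationSum 2 (fibreFn c b) u
      = (⌊1 / u⌋₊ : ℂ) - (⌊(1 / 2) / u⌋₊ : ℂ) + ∑ j, c j * (⌊b j / u⌋₊ : ℂ) := by
  unfold dilationSum fibreFn
  simp only [Finset.sum_add_distrib, Finset.sum_sub_distrib]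
  rw [sum_piece_eq_floor hu zero_le_one (by norm_num),
    sum_piece_eq_floor hu (by norm_num) (by norm_num), Finset.sum_comm]
  congr 1
  refine Finset.sum_congr rfl fun j _ ↦ ?_
  rw [← Finset.mul_sum, sum_piece_eq_floor hu (hb j).1.le (by linarith [(hb j).2])]

/-- `⌊y⌋ = y - {y}` for `y ≥ 0`, as complex numbers. -/
theorem natFloor_eq_sub_fract {y : ℝ} (hy : 0 ≤ y) :
    ((⌊y⌋₊ : ℕ) : ℂ) = (y : ℂ) - ((Int.fract y : ℝ) : ℂ) := by
  have h1 : ((⌊y⌋₊ : ℕ) : ℝ) = ((⌊y⌋ : ℤ) : ℝ) := natCast_floor_eq_intCast_floor hy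
  have h2 : ((⌊y⌋ : ℤ) : ℝ) = y - Int.fract y := by rw [Int.fract]; ring
  rw [show ((⌊y⌋₊ : ℕ) : ℂ) = (((⌊y⌋₊ : ℕ) : ℝ) : ℂ) by push_cast; rfl, h1, h2]
  push_cast; ring

/-- The Beurling form of the dilation sum on a mass-zero fibre:
`θ_f(u) = -({1/u} - {1/(2u)} + Σ_j c_j {b_j/u})`. -/
theorem dilationSum_fibreFn_eq {n : ℕ} (c : Fin n → ℂ) (b : Fin n → ℝ)
    (hb : ∀ j, 0 < b j ∧ b j ≤ 1 / 2) (hmass : ∑ j, c j * (b j : ℂ) = -(1 / 2 : ℂ))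
    {u : ℝ} (hu : 0 < u) :
    dilationSum 2 (fibreFn c b) u
      = -(((Int.fract (1 / u) : ℝ) : ℂ) - ((Int.fract ((1 / 2) / u) : ℝ) : ℂ)
          + ∑ j, c j * ((Int.fract (b j / u) : ℝ) : ℂ)) := by
  rw [dilationSum_fibreFn c b hb hu, natFloor_eq_sub_fract (by positivity),
    natFloor_eq_sub_fract (by positivity)]
  rw [Finset.sum_congr rfl fun j _ ↦ by rw [natFloor_eq_sub_fract (by have := (hb j).1; positivity)]]
  have hu0 : (u : ℂ) ≠ 0 := by exact_mod_cast hu.ne'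
  have hsum : ∑ j, c j * (((b j / u : ℝ)) : ℂ) = (∑ j, c j * (b j : ℂ)) / (u : ℂ) := by
    rw [Finset.sum_div]
    refine Finset.sum_congr rfl fun j _ ↦ ?_
    push_cast; ring
  simp only [mul_sub, Finset.sum_sub_distrib]
  rw [hsum, hmass]
  push_cast
  field_simp
  ring

/-- The Beurling form is bounded: `‖θ_f(u)‖ ≤ 2 + Σ ‖c_j‖`. -/
theorem norm_dilationSum_fibreFn_le {n : ℕ} (c : Fin n → ℂ) (b : Fin n → ℝ)
    (hb : ∀ j, 0 < b j ∧ b j ≤ 1 / 2) (hmass : ∑ j, c j * (b j : ℂ) = -(1 / 2 : ℂ))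
    {u : ℝ} (hu : 0 < u) :
    ‖dilationSum 2 (fibreFn c b) u‖ ≤ 2 + ∑ j, ‖c j‖ := by
  rw [dilationSum_fibreFn_eq c b hb hmass hu, norm_neg]
  have hf : ∀ y : ℝ, ‖((Int.fract y : ℝ) : ℂ)‖ ≤ 1 := fun y ↦ by
    rw [Complex.norm_real, Real.norm_eq_abs, abs_of_nonneg (Int.fract_nonneg _)]
    exact (Int.fract_lt_one _).le
  calc ‖((Int.fract (1 / u) : ℝ) : ℂ) - ((Int.fract ((1 / 2) / u) : ℝ) : ℂ)
          + ∑ j, c j * ((Int.fract (b j / u) : ℝ) : ℂ)‖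
      ≤ ‖((Int.fract (1 / u) : ℝ) : ℂ) - ((Int.fract ((1 / 2) / u) : ℝ) : ℂ)‖
          + ‖∑ j, c j * ((Int.fract (b j / u) : ℝ) : ℂ)‖ := norm_add_le _ _
    _ ≤ (1 + 1) + ∑ j, ‖c j‖ * 1 := by
        gcongr
        · exact (norm_sub_le _ _).trans (add_le_add (hf _) (hf _))
        · exact (norm_sum_le _ _).trans (Finset.sum_le_sum fun j _ ↦ by
            rw [norm_mul]; exact mul_le_mul_of_nonneg_left (hf _) (norm_nonneg _))
    _ = 2 + ∑ j, ‖c j‖ := by simp; norm_num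

/-! ## Nyman's integrals on `(0, 1/2]` -/

/-- `N(b) := ∫_0^{1/2} {b/u} u^{s-1} du`. -/
def nymanInt (b : ℝ) (s : ℂ) : ℂ :=
  ∫ u in Set.Ioc (0 : ℝ) (1 / 2), ((Int.fract (b / u) : ℝ) : ℂ) * (u : ℂ) ^ (s - 1)

/-- For `0 < b ≤ 1/2`: `N(b) = 2^{-s} (2b/(s-1) - (1/(2b))^{-s} ζ(s)/s)` — Nyman's formula (tree
`mellin_beurlingRhoTrunc_eq` with `k = 1/(2b) ≥ 1`) after the dilation `u = t/2`
(`mellin_comp_mul_left`). [cite: Titchmarsh1986, §2.1 (2.1.5)] -/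
theorem nymanInt_small {b : ℝ} (hb0 : 0 < b) (hb : b ≤ 1 / 2) {s : ℂ} (hre : 0 < s.re)
    (hs1 : s ≠ 1) :
    nymanInt b s = (2 : ℂ) ^ (-s) *
      (1 / (((1 / (2 * b) : ℝ) : ℂ) * (s - 1))
        - (((1 / (2 * b) : ℝ) : ℂ)) ^ (-s) * riemannZeta s / s) := by
  set k : ℝ := 1 / (2 * b) with hk
  have hk1 : 1 ≤ k := by rw [hk, le_div_iff₀ (by positivity)]; linarith
  have hmel := mellin_beurlingRhoTrunc_eq hk1 hre hs1
  have hcomp := mellin_comp_mul_left (beurlingRhoTrunc k) s (a := 2) two_pos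
  rw [hmel, smul_eq_mul, show ((2 : ℝ) : ℂ) = (2 : ℂ) by norm_num] at hcomp
  rw [← hcomp]
  -- identify `N(b)` with the Mellin transform of `t ↦ ρ_k(2t)`
  unfold nymanInt mellin
  have hind : ∀ t : ℝ, t ∈ Set.Ioi (0 : ℝ) →
      (t : ℂ) ^ (s - 1) • beurlingRhoTrunc k (2 * t)
        = (Set.Ioc (0 : ℝ) (1 / 2)).indicator
            (fun u : ℝ ↦ ((Int.fract (b / u) : ℝ) : ℂ) * (u : ℂ) ^ (s - 1)) t := by
    intro t ht
    have ht0 : (0 : ℝ) < t := ht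
    unfold beurlingRhoTrunc
    by_cases h2 : t ≤ 1 / 2
    · have hmem : 2 * t ∈ Set.Ioc (0 : ℝ) 1 := ⟨by linarith, by linarith⟩
      have hmem' : t ∈ Set.Ioc (0 : ℝ) (1 / 2) := ⟨ht0, h2⟩
      rw [Set.indicator_of_mem hmem, Set.indicator_of_mem hmem', smul_eq_mul, mul_comm]
      congr 3
      rw [hk]; field_simp
    · have hnm : 2 * t ∉ Set.Ioc (0 : ℝ) 1 := fun h ↦ h2 (by linarith [h.2])
      have hnm' : t ∉ Set.Ioc (0 : ℝ) (1 / 2) := fun h ↦ h2 h.2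
      rw [Set.indicator_of_notMem hnm, Set.indicator_of_notMem hnm', smul_zero]
  rw [setIntegral_congr_fun measurableSet_Ioi hind, setIntegral_indicator measurableSet_Ioc,
    show Set.Ioi (0 : ℝ) ∩ Set.Ioc 0 (1 / 2) = Set.Ioc 0 (1 / 2) from
      Set.inter_eq_right.2 Set.Ioc_subset_Ioi_self]

/-- For the outer piece `b = 1`: `N(1) = (1/(s-1) - ζ(s)/s) - [(1 - (1/2)^{s-1})/(s-1) - (1 - (1/2)^s)/s]`,
splitting `∫_0^1 = ∫_0^{1/2} + ∫_{1/2}^1` and using `{1/u} = 1/u - 1` on `(1/2, 1]`.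
[cite: Titchmarsh1986, §2.1 (2.1.5)] -/
theorem nymanInt_one {s : ℂ} (hre : 1 / 2 < s.re) (hs1 : s ≠ 1) :
    nymanInt 1 s = (1 / (s - 1) - riemannZeta s / s)
      - ((1 - (((1 / 2 : ℝ)) : ℂ) ^ (s - 1)) / (s - 1) - (1 - (((1 / 2 : ℝ)) : ℂ) ^ s) / s) := by
  have hre0 : 0 < s.re := by linarith
  have hs0 : s ≠ 0 := fun h ↦ by rw [h] at hre; norm_num at hre
  have hmel := mellin_beurlingRhoTrunc_eq (k := 1) le_rfl hre0 hs1
  simp only [one_mul, Complex.ofReal_one, Complex.one_cpow] at hmel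
  -- `mellin (ρ_1) s = ∫_{(0,1]} {1/u} u^{s-1}`
  have hconv := mellinConvergent_beurlingRhoTrunc (1 : ℝ) hre0
  unfold MellinConvergent at hconv
  have hint : ∀ t : ℝ, t ∈ Set.Ioi (0 : ℝ) → (t : ℂ) ^ (s - 1) • beurlingRhoTrunc 1 t
      = (Set.Ioc (0 : ℝ) 1).indicator
          (fun u : ℝ ↦ ((Int.fract (1 / u) : ℝ) : ℂ) * (u : ℂ) ^ (s - 1)) t := by
    intro t ht
    unfold beurlingRhoTrunc
    by_cases h : t ∈ Set.Ioc (0 : ℝ) 1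
    · rw [Set.indicator_of_mem h, Set.indicator_of_mem h, smul_eq_mul, one_mul, mul_comm]
    · rw [Set.indicator_of_notMem h, Set.indicator_of_notMem h, smul_zero]
  have hI1 : mellin (beurlingRhoTrunc 1) s
      = ∫ u in Set.Ioc (0 : ℝ) 1, ((Int.fract (1 / u) : ℝ) : ℂ) * (u : ℂ) ^ (s - 1) := by
    unfold mellin
    rw [setIntegral_congr_fun measurableSet_Ioi hint, setIntegral_indicator measurableSet_Ioc,
      show Set.Ioi (0 : ℝ) ∩ Set.Ioc 0 1 = Set.Ioc 0 1 from
        Set.inter_eq_right.2 Set.Ioc_subset_Ioi_self]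
  -- integrability on `(0,1]` of the integrand
  set g : ℝ → ℂ := fun u ↦ ((Int.fract (1 / u) : ℝ) : ℂ) * (u : ℂ) ^ (s - 1) with hg
  have hgI : IntegrableOn g (Set.Ioc 0 1) := by
    have h1 : IntegrableOn (fun t : ℝ ↦ (t : ℂ) ^ (s - 1) • beurlingRhoTrunc 1 t) (Set.Ioc 0 1) :=
      hconv.mono_set Set.Ioc_subset_Ioi_self
    refine h1.congr_fun (fun t ht ↦ ?_) measurableSet_Ioc
    change (t : ℂ) ^ (s - 1) • beurlingRhoTrunc 1 t = g t
    rw [hint t ht.1, Set.indicator_of_mem ht]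
  -- split `(0,1] = (0,1/2] ∪ (1/2,1]`
  have hsplit : ∫ u in Set.Ioc (0 : ℝ) 1, g u
      = (∫ u in Set.Ioc (0 : ℝ) (1 / 2), g u) + ∫ u in Set.Ioc (1 / 2 : ℝ) 1, g u := by
    rw [← Set.Ioc_union_Ioc_eq_Ioc (show (0 : ℝ) ≤ 1 / 2 by norm_num)
      (show (1 / 2 : ℝ) ≤ 1 by norm_num)]
    exact setIntegral_union (Set.Ioc_disjoint_Ioc_of_le le_rfl) measurableSet_Ioc
      (hgI.mono_set (Set.Ioc_subset_Ioc_right (by norm_num)))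
      (hgI.mono_set (Set.Ioc_subset_Ioc_left (by norm_num)))
  -- on `(1/2, 1]`: `{1/u} = 1/u - 1`
  have hpiece : ∫ u in Set.Ioc (1 / 2 : ℝ) 1, g u
      = (1 - (((1 / 2 : ℝ)) : ℂ) ^ (s - 1)) / (s - 1) - (1 - (((1 / 2 : ℝ)) : ℂ) ^ s) / s := by
    have heq : Set.EqOn g (fun u : ℝ ↦ (u : ℂ) ^ (s - 2) - (u : ℂ) ^ (s - 1)) (Set.Ioc (1 / 2) 1) := by
      intro u hu
      have hu0 : 0 < u := by linarith [hu.1]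
      have hfr : Int.fract (1 / u) = 1 / u - 1 := by
        rw [Int.fract, show (⌊1 / u⌋ : ℤ) = 1 from ?_]
        · push_cast; ring
        rw [Int.floor_eq_iff]
        constructor
        · push_cast; rw [le_div_iff₀ hu0]; linarith [hu.2]
        · push_cast; rw [div_lt_iff₀ hu0]; linarith [hu.1]
      simp only [hg, hfr]
      have hu0' : (u : ℂ) ≠ 0 := by exact_mod_cast hu0.ne'
      have e : (u : ℂ) ^ (s - 2) = (u : ℂ) ^ (s - 1) * (u : ℂ)⁻¹ := by
        rw [show s - 2 = (s - 1) + (-1) by ring, Complex.cpow_add _ _ hu0', Complex.cpow_neg_one]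
      rw [e]
      push_cast
      field_simp
    rw [setIntegral_congr_fun measurableSet_Ioc heq, ← intervalIntegral.integral_of_le (by norm_num),
      intervalIntegral.integral_sub, integral_cpow, integral_cpow]
    · push_cast
      simp only [Complex.one_cpow, show s - 2 + 1 = s - 1 by ring, show s - 1 + 1 = s by ring]
    · right; refine ⟨fun h ↦ hs0 (by linear_combination h), ?_⟩
      rw [Set.uIcc_of_le (by norm_num)]; exact fun h ↦ by linarith [h.1]
    · right; refine ⟨fun h ↦ hs1 (by linear_combination h), ?_⟩
      rw [Set.uIcc_of_le (by norm_num)]; exact fun h ↦ by linarith [h.1]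
    · exact (intervalIntegral.intervalIntegrable_cpow (r := s - 2) (Or.inr (by
        rw [Set.uIcc_of_le (by norm_num)]; exact fun h ↦ by linarith [h.1])))
    · exact (intervalIntegral.intervalIntegrable_cpow (r := s - 1) (Or.inr (by
        rw [Set.uIcc_of_le (by norm_num)]; exact fun h ↦ by linarith [h.1])))
  have hN : nymanInt 1 s = ∫ u in Set.Ioc (0 : ℝ) (1 / 2), g u := rfl
  rw [hN, eq_sub_iff_add_eq, ← hpiece, ← hsplit, ← hI1, hmel]

/-! ## The base-2 powers used in THEOREM N(b) -/

/-- `(1/2)^w` in terms of `2^{-s}`: `(1/2)^s = 2^{-s}` and `(1/2)^{s-1} = 2 · 2^{-s}`. -/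
theorem half_cpow (s : ℂ) :
    (((1 / 2 : ℝ)) : ℂ) ^ s = (2 : ℂ) ^ (-s) ∧
      (((1 / 2 : ℝ)) : ℂ) ^ (s - 1) = 2 * (2 : ℂ) ^ (-s) := by
  have h2 : (2 : ℂ) ≠ 0 := two_ne_zero
  have harg : (2 : ℂ).arg ≠ π := by
    rw [show (2 : ℂ) = ((2 : ℝ) : ℂ) by norm_num, Complex.arg_ofReal_of_nonneg (by norm_num)]
    exact Real.pi_pos.ne
  have hhalf : (((1 / 2 : ℝ)) : ℂ) = (2 : ℂ)⁻¹ := by push_cast; ring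
  rw [hhalf, Complex.inv_cpow _ _ harg, Complex.inv_cpow _ _ harg, Complex.cpow_neg,
    Complex.cpow_sub _ _ h2, Complex.cpow_one]
  constructor
  · rfl
  · field_simp

end LatticeUncertainty

end Summit.RiemannHypothesis.RiemannHypothesis.Theorems
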